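import Summits.HubbardSuperconductivity.HubbardSuperconductivity.Theses.NodalDiracTwist
import Literature.MathematicalPhysics.QuantumLattice.SpinTwistedHubbardTorus
import Literature.MathematicalPhysics.QuantumLattice.FockRelabel

/-!
# Route `NodalDiracTwist` — support `RealCyclicOverlap`

`RealCyclicOverlap` (stmt-HubbardSuperconductivity-1626): for the spin-twisted Hubbard torus in the
boost gauge `H_L(U, φ) = -Σ_{x,μ,σ} (e^{i(-1)^σ φ_μ/L} c†_{xσ} c_{x+e_μ,σ} + h.c.) + U Σ_x n_{x↑} n_{x↓}`
(the `let H` inlined in the route items; by `rfl` the tree's `spinTwistedHubbardTorus L U`), if at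
every vertex `φ_i` of a closed polygon of twists the `(N, S^z = 0)`-sector ground state `ψ_i` is
unique up to scalars, then the cyclic overlap product `Π_i ⟨ψ_i, ψ_{i+1}⟩` is REAL.

## Proof (ℤ₂ quantisation by an antiunitary symmetry with `T² = 1`)

Let `F = fockRelabel Orb.spinSwap` be the (real, signed-permutation) Fock-space unitary of the
spin exchange `(x, σ) ↦ (x, 1 - σ)` and `K` entrywise complex conjugation of Fock vectors; put
`T ψ = F (star ψ)`.
* `F H_L(U, φ) F⁻¹ = H_L(U, -φ)` (`relabel_spinSwap_spinTwistedHubbardTorus`: exchanging the spins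
  exchanges the twists `e^{± i φ_μ/L}`), and `K` also sends `H_L(U, φ)` to `H_L(U, -φ)` (tree:
  `spinTwistedHubbardTorus_map_star`, the Jordan–Wigner matrices are real); hence `T` commutes
  with `H_L(U, φ)`.
* `F S^z F⁻¹ = -S^z` (`relabel_spinSwap_spinZ`) and `K` commutes with the real diagonal `S^z`, `N`;
  so `T` maps the sector `(N, S^z = 0)` to itself, and therefore sector ground states to sector
  ground states with the same energy (`isGroundStateInSector_spinFlip_star`).
* Uniqueness gives `T ψ_i = z_i ψ_i`; `T` is norm preserving, so `|z_i| = 1`; and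
  `conj ⟨ψ_i, ψ_j⟩ = ⟨T ψ_i, T ψ_j⟩ = conj(z_i) z_j ⟨ψ_i, ψ_j⟩`. Around the closed polygon the phases
  telescope: `conj Π_i ⟨ψ_i, ψ_{i+1}⟩ = (Π_i conj(z_i) z_{i+1}) Π_i ⟨ψ_i, ψ_{i+1}⟩ = Π_i ⟨ψ_i, ψ_{i+1}⟩`.

Sources: Y. Hatsugai, J. Phys. Soc. Jpn. 75 (2006) 123601 (quantised Berry phases from an
antiunitary symmetry); H. Tasaki, *Physics and Mathematics of Quantum Many-Body Systems* (2020)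
§9.2 (Jordan–Wigner signs); O. Bratteli, D. W. Robinson, *Operator Algebras and QSM II* §5.2.2
(unitary implementation of one-particle permutations). No new definitions, no named facts.
-/

-- the mandated namespace `Summit.<Summit>.<Problem>.Theorems` repeats `HubbardSuperconductivity`
-- (single-problem summit, D-0017), which the `dupNamespace` linter flags on every declaration
set_option linter.dupNamespace false

noncomputable section

namespace Summit.HubbardSuperconductivity.HubbardSuperconductivity.Theorems.NodalDiracTwist

open Matrix Literature.MathematicalPhysics.QuantumLattice
open Summit.HubbardSuperconductivity.HubbardSuperconductivity.Theses.NodalDiracTwist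
open scoped ComplexOrder

/-! ### Generic facts: complex conjugation of Fock vectors, unitarity of `fockRelabel` -/

section Generic

variable {ι ι' : Type*} [LinearOrder ι] [Fintype ι] [LinearOrder ι'] [Fintype ι']

/-- `relabel` respects negation. [folklore] -/
theorem relabel_neg (e : ι ≃ ι') (a : Matrix (Finset ι) (Finset ι) ℂ) :
    relabel e (-a) = -relabel e a :=
  map_neg (relabel e) a

omit [LinearOrder ι] in
/-- Entrywise complex conjugation `K` of Fock vectors intertwines `M` and its entrywise conjugate:
`K (M ψ) = M̄ (K ψ)`. [folklore] -/
theorem star_mulVec_eq_map_star_mulVec (M : Matrix (Finset ι) (Finset ι) ℂ) (ψ : Fock ι) :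
    star (M *ᵥ ψ) = M.map star *ᵥ star ψ := by
  funext s
  simp only [Pi.star_apply, Matrix.mulVec, dotProduct, Matrix.map_apply, star_sum, star_mul']

/-- **`U_π` is unitary on inner products**: `⟨U_π v, U_π w⟩ = ⟨v, w⟩`.
Bratteli–Robinson II §5.2.2, Thm. 5.2.5. [folklore] -/
theorem star_fockRelabel_mulVec_dotProduct_fockRelabel_mulVec (π : Equiv.Perm ι) (v w : Fock ι) :
    star ((fockRelabel π).val *ᵥ v) ⬝ᵥ ((fockRelabel π).val *ᵥ w) = star v ⬝ᵥ w := by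
  rw [fockRelabel_val, star_mulVec, ← dotProduct_mulVec, mulVec_mulVec,
    conjTranspose_mul_relabelMatrix, one_mulVec]

end Generic

/-! ### Spin exchange: `F n_{xσ} F⁻¹ = n_{x,1-σ}`, `F S^z F⁻¹ = -S^z`, and the sectors -/

section SpinSwap

variable {Λ : Type*} [LinearOrder Λ] [Fintype Λ]

/-- `Γ n_{xσ} Γ⁻¹ = n_{x, 1-σ}` under the spin exchange `Γ = relabel Orb.spinSwap`.
Benfatto–Giuliani–Mastropietro (2006) §2.1, symmetry (1). [folklore] -/
theorem relabel_spinSwap_numberOp (x : Λ) (σ : Fin 2) :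
    relabel (Orb.spinSwap : Orb Λ ≃ Orb Λ) (numberOp x σ) =
      numberOp x (Equiv.swap (0 : Fin 2) 1 σ) := by
  rw [numberOp, relabel_mul, relabel_creation, relabel_annihilation, Orb.spinSwap_orb, numberOp]

/-- **Spin exchange reverses `S^z`**: `Γ S^z Γ⁻¹ = -S^z`. Lieb, PRL 62 (1989) 1201, eq. (2).
[folklore] -/
theorem relabel_spinSwap_spinZ :
    relabel (Orb.spinSwap : Orb Λ ≃ Orb Λ)
        (HubbardWave0.spinZ : Matrix (Finset (Orb Λ)) (Finset (Orb Λ)) ℂ) =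
      -HubbardWave0.spinZ := by
  rw [HubbardWave0.spinZ, relabel_smul, relabel_sum, ← smul_neg, ← Finset.sum_neg_distrib]
  congr 1
  refine Finset.sum_congr rfl fun x _ => ?_
  rw [relabel_sub, relabel_spinSwap_numberOp, relabel_spinSwap_numberOp, Equiv.swap_apply_left,
    Equiv.swap_apply_right, neg_sub]

/-- Complex conjugation `K` preserves the joint sectors `(N, S^z = M)` (`N` and `S^z` are real
diagonal matrices in the occupation basis). [folklore] -/
theorem star_mem_szSector {N : ℕ} {M : ℝ} {ψ : Fock (Orb Λ)} (hψ : ψ ∈ szSector N M) :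
    star ψ ∈ szSector N M := by
  rw [mem_szSector_iff] at hψ ⊢
  refine ⟨fun s hs => by rw [Pi.star_apply, hψ.1 s hs, star_zero], ?_⟩
  funext s
  have h := congrFun hψ.2 s
  rw [LiebThm1.spinZ_mulVec_apply, Pi.smul_apply, smul_eq_mul] at h ⊢
  rw [Pi.star_apply]
  by_cases h0 : ψ s = 0
  · rw [h0, star_zero, mul_zero, mul_zero]
  · rw [mul_right_cancel₀ h0 h]

/-- **The spin flip `F = fockRelabel Orb.spinSwap` maps the sector `(N, S^z = 0)` to itself**
(`F N F⁻¹ = N`, `F S^z F⁻¹ = -S^z`). Lieb, PRL 62 (1989) 1201, eq. (2). [folklore] -/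
theorem fockRelabel_spinSwap_mulVec_mem_szSector {N : ℕ} {ψ : Fock (Orb Λ)}
    (hψ : ψ ∈ szSector N 0) :
    (fockRelabel (Orb.spinSwap : Orb Λ ≃ Orb Λ)).val *ᵥ ψ ∈ szSector N 0 := by
  rw [mem_szSector_iff] at hψ ⊢
  obtain ⟨hN, hS⟩ := hψ
  refine ⟨hN.fockRelabel_mulVec _, ?_⟩
  have hF : (fockRelabel (Orb.spinSwap : Orb Λ ≃ Orb Λ)).val * HubbardWave0.spinZ =
      -HubbardWave0.spinZ * (fockRelabel (Orb.spinSwap : Orb Λ ≃ Orb Λ)).val :=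
    fockRelabel_mul_eq_of_conj_eq _ (by rw [← relabel_eq_fockRelabel_conj, relabel_spinSwap_spinZ])
  rw [Complex.ofReal_zero, zero_smul] at hS ⊢
  have h1 : HubbardWave0.spinZ * (fockRelabel (Orb.spinSwap : Orb Λ ≃ Orb Λ)).val =
      -((fockRelabel (Orb.spinSwap : Orb Λ ≃ Orb Λ)).val * HubbardWave0.spinZ) := by
    rw [hF, neg_mul, neg_neg]
  rw [mulVec_mulVec, h1, neg_mulVec, ← mulVec_mulVec, hS, mulVec_zero, neg_zero]

end SpinSwap

/-! ### The antiunitary symmetry `T = F ∘ K` of the spin-twisted torus -/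

section Torus

variable (L : ℕ) [NeZero L]

/-- **Spin exchange reverses the spin twist of the hopping**:
`Γ T_L(φ) Γ⁻¹ = T_L(-φ)` (spin `σ` carries the phase `e^{i(-1)^σ φ_μ/L}`).
Karakuzu–Seki–Sorella, PRB 98 (2018) 075156, Sec. II D. [folklore] -/
theorem relabel_spinSwap_spinTwistedHopping (φ : Fin 2 → ℝ) :
    relabel (Orb.spinSwap : Orb (FermionTorus 2 L) ≃ Orb (FermionTorus 2 L))
        (spinTwistedHopping L φ) = spinTwistedHopping L (-φ) := by
  unfold spinTwistedHopping
  rw [relabel_sum]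
  refine Finset.sum_congr rfl fun x _ => ?_
  rw [relabel_sum]
  refine Finset.sum_congr rfl fun μ _ => ?_
  rw [relabel_sum]
  simp only [Fin.sum_univ_two, relabel_add, relabel_smul, relabel_mul, relabel_creation,
    relabel_annihilation, Orb.spinSwap_orb, Equiv.swap_apply_left, Equiv.swap_apply_right,
    Fin.val_zero, Fin.val_one, pow_zero, pow_one, one_mul, neg_mul, Pi.neg_apply, mul_neg,
    neg_neg, neg_div, Complex.ofReal_neg]
  abel

/-- **Spin exchange reverses the twist**: `F H_L(U, φ) F⁻¹ = H_L(U, -φ)` for the spin-flip unitary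
`F = fockRelabel Orb.spinSwap` (the on-site interaction `n_{x↑} n_{x↓}` is fixed). With the
reality `K H_L(U, φ) K = H_L(U, -φ)` this makes `T = F ∘ K` an antiunitary symmetry of `H_L(U, φ)`
with `T² = 1`. Hatsugai, J. Phys. Soc. Jpn. 75 (2006) 123601. [folklore] -/
theorem relabel_spinSwap_spinTwistedHubbardTorus (U : ℝ) (φ : Fin 2 → ℝ) :
    relabel (Orb.spinSwap : Orb (FermionTorus 2 L) ≃ Orb (FermionTorus 2 L))
        (spinTwistedHubbardTorus L U φ) = spinTwistedHubbardTorus L U (-φ) := by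
  have hV : relabel (Orb.spinSwap : Orb (FermionTorus 2 L) ≃ Orb (FermionTorus 2 L))
      (∑ x : FermionTorus 2 L, numberOp x 0 * numberOp x 1) =
      ∑ x : FermionTorus 2 L, numberOp x 0 * numberOp x 1 := by
    rw [relabel_sum]
    exact Finset.sum_congr rfl fun x _ => relabel_spinSwap_numberOp_mul_numberOp x
  rw [spinTwistedHubbardTorus, spinTwistedHubbardTorus, relabel_add, relabel_neg, relabel_smul,
    relabel_spinSwap_spinTwistedHopping, hV]

/-- **`T = F ∘ K` maps sector ground states to sector ground states.** If `ψ` is a ground state of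
`H_L(U, φ)` in the sector `(N, S^z = 0)`, so is `F (star ψ)`: `T` preserves the sector, is
injective, and `H_L(U,φ) F K ψ = F H_L(U,-φ) K ψ = F K H_L(U,φ) ψ = E · F K ψ` (`E` real).
Hatsugai, J. Phys. Soc. Jpn. 75 (2006) 123601. [folklore] -/
theorem isGroundStateInSector_spinFlip_star {U : ℝ} {φ : Fin 2 → ℝ} {N : ℕ}
    {ψ : Fock (Orb (FermionTorus 2 L))}
    (hψ : IsGroundStateInSector (spinTwistedHubbardTorus L U φ) N 0 ψ) :
    IsGroundStateInSector (spinTwistedHubbardTorus L U φ) N 0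
      ((fockRelabel (Orb.spinSwap : Orb (FermionTorus 2 L) ≃ Orb (FermionTorus 2 L))).val *ᵥ
        star ψ) := by
  obtain ⟨hmem, hne, heig⟩ := hψ
  refine ⟨fockRelabel_spinSwap_mulVec_mem_szSector (star_mem_szSector hmem), ?_, ?_⟩
  · intro h0
    apply hne
    have h1 : star ψ = 0 :=
      fockRelabel_mulVec_injective (Orb.spinSwap : Orb (FermionTorus 2 L) ≃ Orb (FermionTorus 2 L))
        (show _ *ᵥ star ψ = _ *ᵥ (0 : Fock (Orb (FermionTorus 2 L))) by rw [h0, mulVec_zero])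
    simpa using congrArg star h1
  · have hHF : spinTwistedHubbardTorus L U φ *
        (fockRelabel (Orb.spinSwap : Orb (FermionTorus 2 L) ≃ Orb (FermionTorus 2 L))).val =
        (fockRelabel (Orb.spinSwap : Orb (FermionTorus 2 L) ≃ Orb (FermionTorus 2 L))).val *
          spinTwistedHubbardTorus L U (-φ) := by
      refine (fockRelabel_mul_eq_of_conj_eq _ ?_).symm
      rw [← relabel_eq_fockRelabel_conj, relabel_spinSwap_spinTwistedHubbardTorus, neg_neg]
    rw [mulVec_mulVec, hHF, ← mulVec_mulVec, ← spinTwistedHubbardTorus_map_star L U φ,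
      ← star_mulVec_eq_map_star_mulVec, heig, star_smul, mulVec_smul, Complex.star_def,
      Complex.conj_ofReal]

/-- **Reality of the cyclic overlap product** (the content of `RealCyclicOverlap`, stated for the
tree's `spinTwistedHubbardTorus`): if every `ψ_i` is the unique-up-to-scalars ground state of
`H_L(U, φ_i)` in the sector `(N, S^z = 0)`, then `Im Π_i ⟨ψ_i, ψ_{i+1}⟩ = 0`. The antiunitary
symmetry `T = F ∘ K` gives `T ψ_i = z_i ψ_i` with `|z_i| = 1`, and
`conj ⟨ψ_i, ψ_{i+1}⟩ = ⟨T ψ_i, T ψ_{i+1}⟩ = conj(z_i) z_{i+1} ⟨ψ_i, ψ_{i+1}⟩` telescopes around the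
cycle. Hatsugai, J. Phys. Soc. Jpn. 75 (2006) 123601. [folklore] -/
theorem im_prod_cyclicOverlap_eq_zero (U : ℝ) (N n : ℕ) (φs : Fin n → Fin 2 → ℝ)
    (ψ : Fin n → Fock (Orb (FermionTorus 2 L)))
    (hgs : ∀ i, IsGroundStateInSector (spinTwistedHubbardTorus L U (φs i)) N 0 (ψ i))
    (huniq : ∀ i χ, IsGroundStateInSector (spinTwistedHubbardTorus L U (φs i)) N 0 χ →
      ∃ z : ℂ, χ = z • ψ i) :
    (∏ i : Fin n, star (ψ i) ⬝ᵥ ψ (finRotate n i)).im = 0 := by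
  -- `T ψ_i = z_i ψ_i`
  choose z hz using fun i =>
    huniq i _ (isGroundStateInSector_spinFlip_star L (hgs i))
  -- `⟨T ψ_i, T ψ_j⟩ = conj(z_i) z_j ⟨ψ_i, ψ_j⟩ = conj ⟨ψ_i, ψ_j⟩`
  have hT : ∀ i j, star (z i) * z j * (star (ψ i) ⬝ᵥ ψ j) = star (star (ψ i) ⬝ᵥ ψ j) := by
    intro i j
    have h1 := star_fockRelabel_mulVec_dotProduct_fockRelabel_mulVec
      (Orb.spinSwap : Orb (FermionTorus 2 L) ≃ Orb (FermionTorus 2 L)) (star (ψ i)) (star (ψ j))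
    rwa [hz i, hz j, star_smul, smul_dotProduct, dotProduct_smul, smul_smul, smul_eq_mul,
      star_dotProduct_star, dotProduct_comm (ψ j) (star (ψ i))] at h1
  -- `|z_i| = 1`
  have hzz : ∀ i, star (z i) * z i = 1 := by
    intro i
    have hne : star (ψ i) ⬝ᵥ ψ i ≠ 0 := fun h => (hgs i).2.1 (dotProduct_star_self_eq_zero.1 h)
    have h1 := hT i i
    rw [← star_dotProduct] at h1
    exact mul_right_cancel₀ hne (h1.trans (one_mul _).symm)
  have hz1 : (∏ i, star (z i)) * ∏ i, z i = 1 := by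
    rw [← Finset.prod_mul_distrib]
    exact Finset.prod_eq_one fun i _ => hzz i
  -- the phases telescope around the cycle
  have hconj : star (∏ i : Fin n, star (ψ i) ⬝ᵥ ψ (finRotate n i)) =
      ∏ i : Fin n, star (ψ i) ⬝ᵥ ψ (finRotate n i) := by
    rw [star_prod]
    simp_rw [← hT]
    rw [Finset.prod_mul_distrib, Finset.prod_mul_distrib, Equiv.prod_comp (finRotate n) z, hz1,
      one_mul]
  exact Complex.conj_eq_iff_im.1 hconj

/-- **`RealCyclicOverlap`** (stmt-HubbardSuperconductivity-1626): the cyclic overlap product of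
unique `(N, S^z = 0)`-sector ground states of the spin-twisted Hubbard torus around any closed
polygon of twists is real (`Im = 0`), for any choice of phases — the ℤ₂ quantisation lemma from the
antiunitary symmetry `T = F ∘ K`, `T² = 1`. The inlined `let H` is the tree's
`spinTwistedHubbardTorus L U` by `rfl` (`spinTwistedHubbardTorus_eq_inline`).
Hatsugai, J. Phys. Soc. Jpn. 75 (2006) 123601; Tasaki (2020) §9.2. [folklore] -/
theorem realCyclicOverlap_proof :
    Summit.HubbardSuperconductivity.HubbardSuperconductivity.Theses.NodalDiracTwist.RealCyclicOverlap := by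
  intro L _ U N n φs ψ
  exact im_prod_cyclicOverlap_eq_zero L U N n φs ψ

end Torus

end Summit.HubbardSuperconductivity.HubbardSuperconductivity.Theorems.NodalDiracTwist

end
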